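import Literature.Analysis.PDE.ParabolicHolderCompactness
import HarnessLib

/-!
# Parabolic Lipschitz bounds for a time-dependent change of the space variable

Topic `Literature/Analysis/PDE`.  If `θ : spacetime → E₂` satisfies the regularity guard on an open
set containing the product region `B × I` (`B` convex, `I` convex) with `‖D θ‖ ≤ A₁` and
`‖∂ₜ θ‖ ≤ Aₜ` there, then for `Ξ, Ξ' ∈ B × I` at parabolic distance `d ≤ D`,

  `‖θ Ξ - θ Ξ'‖ ≤ (A₁ + Aₜ D) d`   and   `d_par ((θ Ξ, t), (θ Ξ', t')) ≤ max (A₁ + Aₜ D) 1 · d`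

(mean value inequality in space, then in time; `|t - t'| ≤ d²`).  This is the Lipschitz input of
the parabolic chain rule (`ParabolicChainRule.lean`) for re-graphing (White 2005, p. 1499).

Everything is PROVED; no definitions, no named facts.

## References

* B. White, *A local regularity theorem for mean curvature flow*, Ann. of Math. 161 (2005), §2.1,
  §2.5. [White2005]
-/

noncomputable section

open Metric Set Filter
open scoped NNReal Topology

namespace Literature.Analysis.PDE

namespace Parabolic

variable {E₁ E₂ : Type*} [NormedAddCommGroup E₁] [NormedSpace ℝ E₁] [NormedAddCommGroup E₂]
  [NormedSpace ℝ E₂]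

/-- **Space increments**: `‖θ (ξ, t) - θ (ξ', t)‖ ≤ A₁ ‖ξ - ξ'‖` on a convex spatial slice.
[folklore] -/
theorem norm_sub_space_le_of_spaceDeriv {θ : Parabolic E₁ → E₂} {W : Set (Parabolic E₁)}
    (hθ : IsC21On θ W) {B : Set E₁} (hB : Convex ℝ B) {t : ℝ}
    (hBW : ∀ ξ ∈ B, (⟨ξ, t⟩ : Parabolic E₁) ∈ W) {A₁ : ℝ}
    (hA₁ : ∀ ξ ∈ B, ‖spaceDeriv θ ⟨ξ, t⟩‖ ≤ A₁) {ξ ξ' : E₁} (hξ : ξ ∈ B) (hξ' : ξ' ∈ B) :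
    ‖θ ⟨ξ, t⟩ - θ ⟨ξ', t⟩‖ ≤ A₁ * ‖ξ - ξ'‖ := by
  have h := hB.norm_image_sub_le_of_norm_hasFDerivWithin_le
    (f := fun ξ => θ ⟨ξ, t⟩) (f' := fun ξ => spaceDeriv θ ⟨ξ, t⟩)
    (fun ξ hξ => (hθ.hasFDerivAt_space (hBW ξ hξ)).hasFDerivWithinAt) hA₁ hξ' hξ
  simpa using h

/-- **Time increments**: `‖θ (ξ, t) - θ (ξ, t')‖ ≤ Aₜ |t - t'|` on a convex time slice.
[folklore] -/
theorem norm_sub_time_le_of_timeDeriv {θ : Parabolic E₁ → E₂} {W : Set (Parabolic E₁)}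
    (hθ : IsC21On θ W) {I : Set ℝ} (hI : Convex ℝ I) {ξ : E₁}
    (hIW : ∀ t ∈ I, (⟨ξ, t⟩ : Parabolic E₁) ∈ W) {Aₜ : ℝ}
    (hAₜ : ∀ t ∈ I, ‖timeDeriv θ ⟨ξ, t⟩‖ ≤ Aₜ) {t t' : ℝ} (ht : t ∈ I) (ht' : t' ∈ I) :
    ‖θ ⟨ξ, t⟩ - θ ⟨ξ, t'⟩‖ ≤ Aₜ * |t - t'| := by
  have h := hI.norm_image_sub_le_of_norm_hasDerivWithin_le
    (f := fun s => θ ⟨ξ, s⟩) (f' := fun s => timeDeriv θ ⟨ξ, s⟩)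
    (fun s hs => (hθ.hasDerivAt_time (hIW s hs)).hasDerivWithinAt) hAₜ ht' ht
  simpa using h

/-- **Parabolic Lipschitz bound for `θ`** on a product region `B × I`: for `d_par (Ξ, Ξ') ≤ D`,
`‖θ Ξ - θ Ξ'‖ ≤ (A₁ + Aₜ D) d_par (Ξ, Ξ')`. [folklore] -/
theorem norm_sub_le_of_jets {θ : Parabolic E₁ → E₂} {W : Set (Parabolic E₁)} (hθ : IsC21On θ W)
    {B : Set E₁} (hB : Convex ℝ B) {I : Set ℝ} (hI : Convex ℝ I)
    (hW : ∀ ξ ∈ B, ∀ t ∈ I, (⟨ξ, t⟩ : Parabolic E₁) ∈ W) {A₁ Aₜ D : ℝ} (hAt0 : 0 ≤ Aₜ)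
    (hA₁ : ∀ ξ ∈ B, ∀ t ∈ I, ‖spaceDeriv θ ⟨ξ, t⟩‖ ≤ A₁)
    (hAₜ : ∀ ξ ∈ B, ∀ t ∈ I, ‖timeDeriv θ ⟨ξ, t⟩‖ ≤ Aₜ)
    {Ξ Ξ' : Parabolic E₁} (hΞ : Ξ.x ∈ B ∧ Ξ.t ∈ I) (hΞ' : Ξ'.x ∈ B ∧ Ξ'.t ∈ I)
    (hD : dist Ξ Ξ' ≤ D) :
    ‖θ Ξ - θ Ξ'‖ ≤ (A₁ + Aₜ * D) * dist Ξ Ξ' := by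
  have h1 : ‖θ ⟨Ξ.x, Ξ.t⟩ - θ ⟨Ξ'.x, Ξ.t⟩‖ ≤ A₁ * ‖Ξ.x - Ξ'.x‖ :=
    norm_sub_space_le_of_spaceDeriv hθ hB (fun ξ hξ => hW ξ hξ _ hΞ.2)
      (fun ξ hξ => hA₁ ξ hξ _ hΞ.2) hΞ.1 hΞ'.1
  have h2 : ‖θ ⟨Ξ'.x, Ξ.t⟩ - θ ⟨Ξ'.x, Ξ'.t⟩‖ ≤ Aₜ * |Ξ.t - Ξ'.t| :=
    norm_sub_time_le_of_timeDeriv hθ hI (fun t ht => hW _ hΞ'.1 t ht)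
      (fun t ht => hAₜ _ hΞ'.1 t ht) hΞ.2 hΞ'.2
  have hx : ‖Ξ.x - Ξ'.x‖ ≤ dist Ξ Ξ' := by rw [← dist_eq_norm]; exact dist_x_le Ξ Ξ'
  have ht : |Ξ.t - Ξ'.t| ≤ dist Ξ Ξ' ^ 2 := by rw [← Real.dist_eq]; exact dist_t_le_sq Ξ Ξ'
  have hd : 0 ≤ dist Ξ Ξ' := dist_nonneg
  have hA10 : 0 ≤ A₁ := by
    have := (norm_nonneg _).trans (hA₁ _ hΞ.1 _ hΞ.2)
    exact this
  calc ‖θ Ξ - θ Ξ'‖ = ‖(θ ⟨Ξ.x, Ξ.t⟩ - θ ⟨Ξ'.x, Ξ.t⟩) + (θ ⟨Ξ'.x, Ξ.t⟩ - θ ⟨Ξ'.x, Ξ'.t⟩)‖ := by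
        congr 1; abel
    _ ≤ A₁ * ‖Ξ.x - Ξ'.x‖ + Aₜ * |Ξ.t - Ξ'.t| := (norm_add_le _ _).trans (add_le_add h1 h2)
    _ ≤ A₁ * dist Ξ Ξ' + Aₜ * (dist Ξ Ξ' * D) := by
        refine add_le_add (mul_le_mul_of_nonneg_left hx hA10) (mul_le_mul_of_nonneg_left ?_ hAt0)
        calc |Ξ.t - Ξ'.t| ≤ dist Ξ Ξ' ^ 2 := ht
          _ = dist Ξ Ξ' * dist Ξ Ξ' := sq _
          _ ≤ dist Ξ Ξ' * D := mul_le_mul_of_nonneg_left hD hd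
    _ = (A₁ + Aₜ * D) * dist Ξ Ξ' := by ring

/-- **Parabolic Lipschitz bound for `Θ = (θ, t)`** on a product region `B × I`: for
`d_par (Ξ, Ξ') ≤ D`, `d_par ((θ Ξ, t), (θ Ξ', t')) ≤ max (A₁ + Aₜ D) 1 · d_par (Ξ, Ξ')`.
[folklore] -/
theorem dist_scomp_le_of_jets {θ : Parabolic E₁ → E₂} {W : Set (Parabolic E₁)} (hθ : IsC21On θ W)
    {B : Set E₁} (hB : Convex ℝ B) {I : Set ℝ} (hI : Convex ℝ I)
    (hW : ∀ ξ ∈ B, ∀ t ∈ I, (⟨ξ, t⟩ : Parabolic E₁) ∈ W) {A₁ Aₜ D : ℝ} (hAt0 : 0 ≤ Aₜ)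
    (hA₁ : ∀ ξ ∈ B, ∀ t ∈ I, ‖spaceDeriv θ ⟨ξ, t⟩‖ ≤ A₁)
    (hAₜ : ∀ ξ ∈ B, ∀ t ∈ I, ‖timeDeriv θ ⟨ξ, t⟩‖ ≤ Aₜ)
    {Ξ Ξ' : Parabolic E₁} (hΞ : Ξ.x ∈ B ∧ Ξ.t ∈ I) (hΞ' : Ξ'.x ∈ B ∧ Ξ'.t ∈ I)
    (hD : dist Ξ Ξ' ≤ D) :
    dist (⟨θ Ξ, Ξ.t⟩ : Parabolic E₂) ⟨θ Ξ', Ξ'.t⟩ ≤ max (A₁ + Aₜ * D) 1 * dist Ξ Ξ' := by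
  have hd : 0 ≤ dist Ξ Ξ' := dist_nonneg
  rw [dist_eq]
  refine max_le ?_ ?_
  · rw [dist_eq_norm]
    exact (norm_sub_le_of_jets hθ hB hI hW hAt0 hA₁ hAₜ hΞ hΞ' hD).trans
      (mul_le_mul_of_nonneg_right (le_max_left _ _) hd)
  · calc Real.sqrt (dist Ξ.t Ξ'.t) ≤ dist Ξ Ξ' := sqrt_dist_t_le Ξ Ξ'
      _ = 1 * dist Ξ Ξ' := (one_mul _).symm
      _ ≤ max (A₁ + Aₜ * D) 1 * dist Ξ Ξ' := mul_le_mul_of_nonneg_right (le_max_right _ _) hd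

end Parabolic

end Literature.Analysis.PDE
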